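import Literature.MathematicalPhysics.QuantumFieldTheory.Balaban1983to89.T4ShellMeasure

/-!
# `T4Continuum.Spine.NE7c.LiveFactorGlobalLevels` — spine estimate NE7c (node U5b), road (δ) THRESHOLD RANDOMISATION:
# a GLOBAL, LEVEL-WISE threshold assignment — ONE perturbed threshold sequence serving EVERY cutoff `K` and both runs
# of every comparison — so that the single-run expansion is written ONCE per cutoff (cell `pub-balaban-gaps`, track G2,
# seat ne8 gen 7; record `HOME/ne/NE7c.md` §14; junction with the NE7b lineage's one-family END of IR-102-2)

HONEST FRAMING.  Finite four-torus programme, rung (B)+1 only — NOT infinite volume, NOT a mass gap, NOT the Clay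
problem, NOT summit progress, NOT a proof of NE7c (`T4IndicatorShell.ShellWeightBound`, INSTANCE 0∕1, which waits on
node O).  Nothing of [Bałaban 1983–89] is asserted: the manuscripts fix their thresholds ONCE and never vary them;
threshold randomisation (road (δ), `Lit.T4ShellMeasure` §6–§8, [folklore]) is the cell's device, and everything below
is finite-sum algebra over abstract nonnegative weights.  Every analytic input is an explicit hypothesis whose located
READING is named; no `def … : Prop` is minted; 0 sorry.  Spine PROVED 0∕9 — unchanged by this file.

THE LOCATED JUNCTION POINT (seat ne8 gen 7, 2026-08-23; zero weight on any design decision).  Road (δ)'s two kernel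
members select the perturbed thresholds PER COMPARISON `K`: `Lit.T4ShellMeasure.exists_threshold_choice_function`
(member (δ-stages): «ONE assignment `c⋆ K` per `K`») and `Lit.T4ShellMeasure.exists_liveFactor_choice_function` ∕
`shellWeightBound_of_liveFactor` (member (δ-1): «one index `i⋆_K` per `K`», output `fun K => A K (istar K)`,
`fun K => B K (istar K)`), and `T4ShellMeasure` §7 says why this is legitimate for the TWO-RUN COMPARISON as typed in
`T4IndicatorShell` ∕ `T4WeightBudget`: «A different `K` may use a different assignment: the compared quantities are
INTEGRALS `Z_K(t) = Σ_τ A K t τ`, which do not depend on the representation».  So in the `K`-th comparison run B (the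
cutoff-`(K+1)` density) is expanded with the `K`-th assignment, and in the `(K+1)`-st comparison the SAME density, now
run A, is expanded with the `(K+1)`-st assignment: TWO representations of one density.  The NE7b lineage's END records
consume NE7c as a FIELD at fixed carriers; in their two-family forms (1R `B16HistoryTowerEndDataLWR.TowerReadDataLWR`,
IR-101-2 `TowerStepDataLWR`: run B over its own parameters `I′ Y νB 𝒢′ RB …`) two representations per density are
expressible, but the ONE-FAMILY form IR-102-2 (`B16HistoryTowerStepRangeDataLWR.TowerStepRangeDataLWR`, (Δ2): «run B
= the same tower family at cutoff `K + 1`», `RB := reprFam T p₀ …`, `weightB μ (reprFam T p₀ …) trunc`) identifies run B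
of comparison `K` with run A of comparison `K + 1` AT THE LEVEL OF REPRESENTATIONS (and, inside comparison `K`, the
truncation `trunc`∕`htr` of run B's histories onto run A's presupposes that `T K` and `T (K + 1)` classify with the SAME
thresholds on the common levels — automatic for print's fixed thresholds, false for two unrelated assignments `c⋆ K`,
`c⋆ (K + 1)`).  Hence: road (δ) AS TYPED (per-`K` assignments) inhabits the `shell` slot of the two-family ENDs only;
under (Δ2) it needs ONE assignment serving all `K`.

THE REPAIR TYPED HERE (member (δ-global)).  Index the candidate thresholds by the ABSOLUTE level `j` (not by the age
inside a comparison's window): `n j ≥ 1` candidates at level `j`, an assignment is `c : ℕ → ℕ` with `c j < n j`, and the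
cutoff-`K` density is expanded ONCE, with the thresholds `c` at all its levels.  Level `j` is BOOKED (carries live,
background-mediated slots) in finitely many comparisons `K ∈ B j` (the bounded live window (W1): `B j ⊆ [j, j + N₁]`).
Two located inputs, both HYPOTHESES here: (R↓) OLDER-ONLY DEPENDENCE — the level-`j` candidate shell weight of a
comparison, summed over the terms, depends on the assignment only through the levels `≤ j` (reading (R) of
`T4ShellMeasure` §8: the tests of a stage are functions of the configuration and the OLDER path, and «the younger
outcomes are summed out first» — the inserted decompositions of unity below a node of the decision tree sum to the
node's indicator; this is the same located reading that discharges (L2a) for member (δ-stages), B15 p. 193 «the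
equivalence means that both sides have equal integrals over the space of fields»); (L2↓) OWN-LEVEL CANDIDATE SUM — with
the other levels frozen, the `n j` candidate shell weights of level `j` sum to at most `V j ×` the comparison's total
weight (disjoint candidate shells, `T4ShellMeasure.sum_indicator_candShell_le_one` ∕ `tree_ownShell_sum_le`; with several
stages inside one level, §8's cascade count gives `V j = 2(∏_σ(ν_σ + 1) − 1)` over the level's stages).  THEN
(`exists_global_level_assignment`): choosing `c j` by INDUCTION ON THE LEVEL — at level `j`, given `c` below `j`, the
pigeonhole over the `n j` candidates of the sum over the comparisons `K ∈ B j` and both runs of the normalised level-`j`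
shell weights — yields ONE assignment with, at every level, `Σ_{K ∈ B j} (w^A_{K,j}/Z^A_K + w^B_{K,j}/Z^B_K) ≤ 2·#(B j)·V j / n j`;
hence (`sum_window_le_of_global`) in every comparison `K` both runs' shell weights summed over the booked levels `W K`
(`j ∈ W K ⇒ K ∈ B j`) are `≤ (Σ_{j ∈ W K} 2·#(B j)·V j / n j) ×` the totals, and (`shellWeightBound_of_globalLevels`) the
§7 realized ledgers give `T4IndicatorShell.ShellWeightBound` BY NAME for the two runs written with the SAME global `c`
— the shape the one-family END's `shell` field has (both runs' weights read off ONE tower family); the window's geometric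
majorant from a per-level rate is `window_sum_le_geometric` (§4, with the bookkeeping `window_books` ∕ `card_books`).

PRICE, LOCATED (for the census `HOME/ne/NE7c.md` §4∕§7 and the dagwriter's D-δ*).  (i) Constants: the factor `#(B j) ≤
N₁ + 1` (each level is selected once for all the comparisons that book it) on top of member (δ-stages)' `2ν_j/n_j` —
harmless for summability (`n j = ⌊β′/ρ_j⌋₊`, `ρ_j` geometric); inside a level with several stages, (δ-1)'s cascade
constant restricted to that level.  (ii) Robustness census: the factors `(1 − ρ_j)^{c j} ∈ [1 − β′, 1]` now DEPEND ON
THE LEVEL and are NOT ordered, so member (δ-1)'s exact invariance of the printed relations BETWEEN thresholds of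
different levels is lost and the located input becomes (L1-levelwise): the seat's pass over all 41 recorded census rows
(`HOME/ne/NE7c.md` §14) finds (L1-levelwise) = (L1-step) ∪ {the CROSS-LEVEL rows 10 ([B15] (1.46)), 13 (p. 192), 22
((1.94)), 23 (window edge), 28 ([B14] (3.8)), 41 ([B16] p. 362)}, each MILD — the ratio `≤ (1 − β′)⁻¹` is absorbed by a
free constant of print (`α`, «γ sufficiently small», `A₁∕A₀`), by print's own rounding slack, or by `exp(−R_k)` — with ONE
located numerical constraint on OUR `β′` ([B14] (3.8) at `L = 2`: `(1 + β₀)∕(1 − β′) < 1.2`; none for `L ≥ 3`); every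
SAME-LEVEL relation, including all cross-kind rows (class C7), is INVARIANT here (one factor per level, all kinds —
unlike under (δ-stages)); upper uses (C3) gain; classes C1 ∕ C8 ∕ C5′ are unchanged — they already price an arbitrary
per-threshold factor `μ ∈ [λ₀, 1]` at any level (`LiveFactorLargeField`, `LiveFactorRestrictedGaussian`); nothing in the
tally uses the ordering that (δ-stages) supplies.  (iii) Gain: ONE expansion per cutoff — print's own convention
(«thresholds fixed once»), node O builds ONE tower family, and the (Δ2) END consumes road (δ) without a second
representation of the cutoff-`(K+1)` density.
NOT HERE: the measure-level discharge of (R↓)∕(L2↓) for Bałaban's expansion (node O); the pages the (L1-step) census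
itself read grep-guided rather than line by line (`HOME/ne/NE7c.md` §7∕§9.1 — unchanged by this member, which adds no
threshold-bearing sentence); U1b's rate; (W1); NE7c NOT proved.
-/

namespace Summit.QuantumFields.BalabanUV.T4Continuum.Spine.NE7c.LiveFactorGlobalLevels

open Finset
open Literature.MathematicalPhysics.QuantumFieldTheory.Balaban1983to89
open Literature.MathematicalPhysics.QuantumFieldTheory.Balaban1983to89.T4ShellMeasure

/-! ## §1 The global level-wise assignment (induction on the level; pigeonhole over the comparisons booking a level) -/

/-- **ONE ASSIGNMENT FOR ALL CUTOFFS.**  Levels `j ∈ ℕ` with `n j ≥ 1` candidate thresholds each; `B j` the finite set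
of comparisons booking level `j`; per comparison `K`, level `j` and assignment `c : ℕ → ℕ` the two runs' level-`j`
candidate shell weights `wA K j c, wB K j c` and candidate-independent positive total-weight floors `ZA K, ZB K`.
HYPOTHESES (located readings, see the module docstring): (R↓) `holdA`∕`holdB` — inside the candidate grid the level-`j`
weight depends on the assignment only through the levels `≤ j`; (L2↓) `hA`∕`hB` — along the own coordinate of level `j` (inside the candidate
grid) the `n j` candidate weights sum to at most `V j ×` the floor.  CONCLUSION: one assignment `c` in the grid with,
at EVERY level, the booked comparisons' normalised shell weights of both runs summing to `≤ 2·#(B j)·V j / n j`.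
Proof: strong recursion on the level — the prefix below `j` is fixed, the level-`j` index is the pigeonhole index of
the finite sum over `K ∈ B j`; (R↓) makes the later choices invisible to level `j`. [folklore] -/
theorem exists_global_level_assignment (n : ℕ → ℕ) (hn : ∀ j, 0 < n j) (B : ℕ → Finset ℕ)
    (wA wB : ℕ → ℕ → (ℕ → ℕ) → ℝ) (ZA ZB : ℕ → ℝ) (hZA : ∀ K, 0 < ZA K) (hZB : ∀ K, 0 < ZB K)
    (holdA : ∀ K j (c c' : ℕ → ℕ), (∀ l, c l < n l) → (∀ l, c' l < n l) → (∀ l, l ≤ j → c l = c' l) →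
      wA K j c = wA K j c')
    (holdB : ∀ K j (c c' : ℕ → ℕ), (∀ l, c l < n l) → (∀ l, c' l < n l) → (∀ l, l ≤ j → c l = c' l) →
      wB K j c = wB K j c')
    (V : ℕ → ℝ)
    (hA : ∀ K j (c : ℕ → ℕ), (∀ l, c l < n l) →
      ∑ m ∈ range (n j), wA K j (Function.update c j m) ≤ V j * ZA K)
    (hB : ∀ K j (c : ℕ → ℕ), (∀ l, c l < n l) →
      ∑ m ∈ range (n j), wB K j (Function.update c j m) ≤ V j * ZB K) :
    ∃ c : ℕ → ℕ, (∀ j, c j < n j) ∧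
      ∀ j, ∑ K ∈ B j, (wA K j c / ZA K + wB K j c / ZB K) ≤ 2 * ((B j).card : ℝ) * V j / n j := by
  classical
  -- the one-level pigeonhole, given a prefix `p` in the grid
  have hstep : ∀ j (p : ℕ → ℕ), (∀ l, p l < n l) → ∃ m, m < n j ∧
      ∑ K ∈ B j, (wA K j (Function.update p j m) / ZA K + wB K j (Function.update p j m) / ZB K)
        ≤ 2 * ((B j).card : ℝ) * V j / n j := by
    intro j p hp
    have hnj : (0 : ℝ) < n j := Nat.cast_pos.mpr (hn j)
    have hsumA : ∀ K ∈ B j, ∑ m ∈ range (n j), wA K j (Function.update p j m) / ZA K ≤ V j := by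
      intro K _
      rw [← sum_div, div_le_iff₀ (hZA K)]
      exact hA K j p hp
    have hsumB : ∀ K ∈ B j, ∑ m ∈ range (n j), wB K j (Function.update p j m) / ZB K ≤ V j := by
      intro K _
      rw [← sum_div, div_le_iff₀ (hZB K)]
      exact hB K j p hp
    have htot : ∑ m ∈ range (n j), ∑ K ∈ B j,
        (wA K j (Function.update p j m) / ZA K + wB K j (Function.update p j m) / ZB K)
          ≤ ∑ _m ∈ range (n j), 2 * ((B j).card : ℝ) * V j / n j := by
      rw [sum_comm]
      calc ∑ K ∈ B j, ∑ m ∈ range (n j),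
            (wA K j (Function.update p j m) / ZA K + wB K j (Function.update p j m) / ZB K)
          ≤ ∑ K ∈ B j, (V j + V j) := by
            refine sum_le_sum fun K hK => ?_
            rw [sum_add_distrib]
            exact add_le_add (hsumA K hK) (hsumB K hK)
        _ = 2 * ((B j).card : ℝ) * V j := by rw [sum_const, nsmul_eq_mul]; ring
        _ = ∑ _m ∈ range (n j), 2 * ((B j).card : ℝ) * V j / n j := by
            rw [sum_const, card_range, nsmul_eq_mul]
            field_simp
    obtain ⟨m, hm, hle⟩ := exists_le_of_sum_le (nonempty_range_iff.mpr (hn j).ne') htot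
    exact ⟨m, mem_range.mp hm, hle⟩
  -- a total version of the step (index `0` outside the grid), so that the recursion needs no side condition
  have hstep' : ∀ j (p : ℕ → ℕ), ∃ m, m < n j ∧ ((∀ l, p l < n l) →
      ∑ K ∈ B j, (wA K j (Function.update p j m) / ZA K + wB K j (Function.update p j m) / ZB K)
        ≤ 2 * ((B j).card : ℝ) * V j / n j) := by
    intro j p
    by_cases hp : ∀ l, p l < n l
    · obtain ⟨m, hm, hle⟩ := hstep j p hp
      exact ⟨m, hm, fun _ => hle⟩
    · exact ⟨0, hn j, fun h => absurd h hp⟩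
  -- the prefixes: `pref 0 = 0`, `pref (j+1) = update (pref j) j (the level-j pigeonhole index given pref j)`
  obtain ⟨pref, h0, hS⟩ : ∃ pref : ℕ → (ℕ → ℕ), pref 0 = (fun _ => 0) ∧
      ∀ j, pref (j + 1) = Function.update (pref j) j (Classical.choose (hstep' j (pref j))) :=
    ⟨fun j => Nat.rec (motive := fun _ => ℕ → ℕ) (fun _ => 0)
        (fun j p => Function.update p j (Classical.choose (hstep' j p))) j, rfl, fun _ => rfl⟩
  -- every prefix lies in the candidate grid
  have hgrid : ∀ j l, pref j l < n l := by
    intro j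
    induction j with
    | zero => intro l; rw [h0]; exact hn l
    | succ j ih =>
        intro l
        rw [hS]
        rcases eq_or_ne l j with hlj | hlj
        · subst hlj
          rw [Function.update_self]
          exact (Classical.choose_spec (hstep' l (pref l))).1
        · rw [Function.update_of_ne hlj]
          exact ih l
  -- the global assignment: the diagonal of the prefixes; it lies in the grid
  have hcgrid : ∀ j, pref (j + 1) j < n j := fun j => by
    simp only [hS, Function.update_self]
    exact (Classical.choose_spec (hstep' j (pref j))).1
  refine ⟨fun l => pref (l + 1) l, hcgrid, fun j => ?_⟩
  · -- the prefixes agree with the diagonal below their index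
    have hagree : ∀ j l, l < j → pref j l = pref (l + 1) l := by
      intro j
      induction j with
      | zero => intro l hl; exact absurd hl (Nat.not_lt_zero l)
      | succ j ih =>
          intro l hl
          rcases Nat.lt_succ_iff_lt_or_eq.mp hl with h | h
          · rw [hS, Function.update_of_ne (Nat.ne_of_lt h)]
            exact ih l h
          · subst h; rfl
    have hG := (Classical.choose_spec (hstep' j (pref j))).2 (hgrid j)
    rw [← hS] at hG
    have hwA : ∀ K, wA K j (pref (j + 1)) = wA K j (fun l => pref (l + 1) l) := fun K =>
      holdA K j _ _ (hgrid (j + 1)) hcgrid fun l hl => hagree (j + 1) l (Nat.lt_succ_of_le hl)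
    have hwB : ∀ K, wB K j (pref (j + 1)) = wB K j (fun l => pref (l + 1) l) := fun K =>
      holdB K j _ _ (hgrid (j + 1)) hcgrid fun l hl => hagree (j + 1) l (Nat.lt_succ_of_le hl)
    simpa only [hwA, hwB] using hG

/-! ## §2 Per comparison: both runs' shell weights over the booked levels -/

/-- From the per-level budget of `exists_global_level_assignment`: in a comparison `K` booking level `j` (`K ∈ B j`)
each run's level-`j` shell weight is at most the level budget `b j ×` the run's floor. [folklore] -/
theorem level_le_of_budget {B : ℕ → Finset ℕ} {wA wB : ℕ → ℕ → (ℕ → ℕ) → ℝ} {ZA ZB : ℕ → ℝ}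
    (hZA : ∀ K, 0 < ZA K) (hZB : ∀ K, 0 < ZB K) (hA0 : ∀ K j c, 0 ≤ wA K j c) (hB0 : ∀ K j c, 0 ≤ wB K j c)
    {c : ℕ → ℕ} {b : ℕ → ℝ} (hbud : ∀ j, ∑ K ∈ B j, (wA K j c / ZA K + wB K j c / ZB K) ≤ b j)
    {K j : ℕ} (hK : K ∈ B j) : wA K j c ≤ b j * ZA K ∧ wB K j c ≤ b j * ZB K := by
  have hsingle : wA K j c / ZA K + wB K j c / ZB K ≤ b j :=
    (single_le_sum (f := fun K => wA K j c / ZA K + wB K j c / ZB K)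
      (fun K' _ => add_nonneg (div_nonneg (hA0 K' j c) (hZA K').le) (div_nonneg (hB0 K' j c) (hZB K').le)) hK).trans
      (hbud j)
  have hAn : 0 ≤ wA K j c / ZA K := div_nonneg (hA0 K j c) (hZA K).le
  have hBn : 0 ≤ wB K j c / ZB K := div_nonneg (hB0 K j c) (hZB K).le
  constructor
  · rw [← div_le_iff₀ (hZA K)]; linarith
  · rw [← div_le_iff₀ (hZB K)]; linarith

/-- **PER COMPARISON.**  With `W K` the levels booked at comparison `K` (`j ∈ W K ⇒ K ∈ B j`), both runs' shell weights
summed over the booked levels are `≤ (Σ_{j ∈ W K} b j) ×` the floors — the input `hqA`∕`hqB` of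
`Lit.T4ShellMeasure.shellWeightBound_of_realized`, now for ONE assignment serving every `K`. [folklore] -/
theorem sum_window_le_of_global {B W : ℕ → Finset ℕ} (hWB : ∀ K j, j ∈ W K → K ∈ B j)
    {wA wB : ℕ → ℕ → (ℕ → ℕ) → ℝ} {ZA ZB : ℕ → ℝ}
    (hZA : ∀ K, 0 < ZA K) (hZB : ∀ K, 0 < ZB K) (hA0 : ∀ K j c, 0 ≤ wA K j c) (hB0 : ∀ K j c, 0 ≤ wB K j c)
    {c : ℕ → ℕ} {b : ℕ → ℝ} (hbud : ∀ j, ∑ K ∈ B j, (wA K j c / ZA K + wB K j c / ZB K) ≤ b j) (K : ℕ) :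
    ∑ j ∈ W K, wA K j c ≤ (∑ j ∈ W K, b j) * ZA K ∧ ∑ j ∈ W K, wB K j c ≤ (∑ j ∈ W K, b j) * ZB K := by
  constructor
  · rw [sum_mul]
    exact sum_le_sum fun j hj => (level_le_of_budget hZA hZB hA0 hB0 hbud (hWB K j hj)).1
  · rw [sum_mul]
    exact sum_le_sum fun j hj => (level_le_of_budget hZA hZB hA0 hB0 hbud (hWB K j hj)).2

/-! ## §3 End to end: `T4IndicatorShell.ShellWeightBound` for the two runs written with ONE global assignment -/

/-- **THE CONSTRUCTOR OF MEMBER (δ-global), END TO END.**  Assignment-indexed data: for every assignment `c` in the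
candidate grid the two runs of EVERY comparison, written with the thresholds `c`, form §7 realized slot ledgers
(`Lit.T4ShellMeasure.SlotLedger.of_realized`: the tilt inequalities of the source, input (L1-levelwise)); the
realized shell totals at source `0` are covered level by level by the candidate weights `wA`∕`wB` of the booked levels
`W K` (`hcovA`∕`hcovB`); (R↓) and (L2↓) as in `exists_global_level_assignment`; floors `ZA K ≤ Σ_τ A c K 0 τ` for every
grid assignment (partition of unity); and the geometric majorant of the level budgets on the bounded window
(`hgeo`, the rate arithmetic of node U1b ∕ (W1) — `Lit.T4ShellMeasure.levelFraction_le_of_rate`,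
`ageSum_le_geometric`).  THEN one global assignment `c` realizes `T4IndicatorShell.ShellWeightBound` BY NAME for the
two runs written with `c` — at every `K` the SAME `c` — with `Wsh K = ω^A_K + ω^B_K ≤ 2e^{2a}C·ϑ^K`. [folklore] -/
theorem shellWeightBound_of_globalLevels {ι σ σ' : Type*} {l₀ a C ϑ : ℝ} {T : ℕ → Finset ι}
    (n : ℕ → ℕ) (hn : ∀ j, 0 < n j) (B W : ℕ → Finset ℕ) (hWB : ∀ K j, j ∈ W K → K ∈ B j)
    {A A' shA shA' : (ℕ → ℕ) → ℕ → ℝ → ι → ℝ} {SA : ℕ → Finset σ} {SA' : ℕ → Finset σ'}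
    {pieceA : (ℕ → ℕ) → ℕ → ℝ → σ → ι → ℝ} {pieceA' : (ℕ → ℕ) → ℕ → ℝ → σ' → ι → ℝ}
    (hLA : ∀ c : ℕ → ℕ, (∀ j, c j < n j) → SlotLedger l₀ T (A c) (shA c) SA (pieceA c)
      (fun K s => Real.exp (2 * a) * ((∑ τ ∈ T K, pieceA c K 0 s τ) / ∑ τ ∈ T K, A c K 0 τ)))
    (hLB : ∀ c : ℕ → ℕ, (∀ j, c j < n j) → SlotLedger l₀ T (A' c) (shA' c) SA' (pieceA' c)
      (fun K s => Real.exp (2 * a) * ((∑ τ ∈ T K, pieceA' c K 0 s τ) / ∑ τ ∈ T K, A' c K 0 τ)))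
    {ZA ZB : ℕ → ℝ} (hZA : ∀ K, 0 < ZA K) (hZB : ∀ K, 0 < ZB K)
    (hZAle : ∀ c : ℕ → ℕ, (∀ j, c j < n j) → ∀ K, ZA K ≤ ∑ τ ∈ T K, A c K 0 τ)
    (hZBle : ∀ c : ℕ → ℕ, (∀ j, c j < n j) → ∀ K, ZB K ≤ ∑ τ ∈ T K, A' c K 0 τ)
    (wA wB : ℕ → ℕ → (ℕ → ℕ) → ℝ) (hA0 : ∀ K j c, 0 ≤ wA K j c) (hB0 : ∀ K j c, 0 ≤ wB K j c)
    (holdA : ∀ K j (c c' : ℕ → ℕ), (∀ l, c l < n l) → (∀ l, c' l < n l) → (∀ l, l ≤ j → c l = c' l) →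
      wA K j c = wA K j c')
    (holdB : ∀ K j (c c' : ℕ → ℕ), (∀ l, c l < n l) → (∀ l, c' l < n l) → (∀ l, l ≤ j → c l = c' l) →
      wB K j c = wB K j c')
    (V : ℕ → ℝ) (hV : ∀ j, 0 ≤ V j)
    (hA : ∀ K j (c : ℕ → ℕ), (∀ l, c l < n l) →
      ∑ m ∈ range (n j), wA K j (Function.update c j m) ≤ V j * ZA K)
    (hB : ∀ K j (c : ℕ → ℕ), (∀ l, c l < n l) →
      ∑ m ∈ range (n j), wB K j (Function.update c j m) ≤ V j * ZB K)
    (hcovA : ∀ c : ℕ → ℕ, (∀ j, c j < n j) → ∀ K,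
      ∑ s ∈ SA K, ∑ τ ∈ T K, pieceA c K 0 s τ ≤ ∑ j ∈ W K, wA K j c)
    (hcovB : ∀ c : ℕ → ℕ, (∀ j, c j < n j) → ∀ K,
      ∑ s ∈ SA' K, ∑ τ ∈ T K, pieceA' c K 0 s τ ≤ ∑ j ∈ W K, wB K j c)
    (hϑ0 : 0 ≤ ϑ) (hϑ1 : ϑ < 1)
    (hgeo : ∀ K, ∑ j ∈ W K, 2 * ((B j).card : ℝ) * V j / n j ≤ C * ϑ ^ K) :
    ∃ c : ℕ → ℕ, ∃ hc : ∀ j, c j < n j,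
      T4IndicatorShell.ShellWeightBound l₀ T (A c) (A' c) (shA c) (shA' c)
        (fun K => (hLA c hc).omega K + (hLB c hc).omega K) := by
  obtain ⟨c, hc, hbud⟩ :=
    exists_global_level_assignment n hn B wA wB ZA ZB hZA hZB holdA holdB V hA hB
  have hb0 : ∀ K, 0 ≤ ∑ j ∈ W K, 2 * ((B j).card : ℝ) * V j / n j := fun K =>
    sum_nonneg fun j _ => div_nonneg (mul_nonneg (by positivity) (hV j)) (Nat.cast_nonneg _)
  have hZA' : ∀ K, 0 < ∑ τ ∈ T K, A c K 0 τ := fun K => (hZA K).trans_le (hZAle c hc K)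
  have hZB' : ∀ K, 0 < ∑ τ ∈ T K, A' c K 0 τ := fun K => (hZB K).trans_le (hZBle c hc K)
  refine ⟨c, hc, shellWeightBound_of_realized (hLA c hc) (hLB c hc) hZA' hZB' hϑ0 hϑ1 (C := C)
    (fun K => ?_) (fun K => ?_)⟩
  · have h := (sum_window_le_of_global hWB hZA hZB hA0 hB0 hbud K).1
    calc ∑ s ∈ SA K, ∑ τ ∈ T K, pieceA c K 0 s τ ≤ ∑ j ∈ W K, wA K j c := hcovA c hc K
      _ ≤ (∑ j ∈ W K, 2 * ((B j).card : ℝ) * V j / n j) * ZA K := h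
      _ ≤ (C * ϑ ^ K) * ∑ τ ∈ T K, A c K 0 τ :=
          mul_le_mul (hgeo K) (hZAle c hc K) (hZA K).le ((hb0 K).trans (hgeo K))
  · have h := (sum_window_le_of_global hWB hZA hZB hA0 hB0 hbud K).2
    calc ∑ s ∈ SA' K, ∑ τ ∈ T K, pieceA' c K 0 s τ ≤ ∑ j ∈ W K, wB K j c := hcovB c hc K
      _ ≤ (∑ j ∈ W K, 2 * ((B j).card : ℝ) * V j / n j) * ZB K := h
      _ ≤ (C * ϑ ^ K) * ∑ τ ∈ T K, A' c K 0 τ :=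
          mul_le_mul (hgeo K) (hZBle c hc K) (hZB K).le ((hb0 K).trans (hgeo K))

/-! ## §4 The bounded window: geometric majorant of the level budgets, bookkeeping `W K = [K − N₁, K]`, `B j = [j, j + N₁]` -/

/-- **THE WINDOW's GEOMETRIC MAJORANT** (the input `hgeo` of `shellWeightBound_of_globalLevels` from a per-level rate):
if the level budgets obey `b j ≤ M·ϑ^j` (for `b j = 2·#(B j)·V j / n j`: `#(B j) ≤ N₁ + 1`, `V j ≤ V̄`, and
`2/n j ≤ D̄ρ_j ≤ D̄c₁ϑ^j` — `Lit.T4ShellMeasure.candidateCount_spec` ∕ `levelFraction_le_of_rate`, node U1b's rate), then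
over the bounded window `[K − N₁, K]` they sum to `≤ ((N₁ + 1)·M·ϑ^{−N₁})·ϑ^K` (`0 < ϑ ≤ 1`; truncated subtraction,
harmless for `K < N₁`). [folklore] -/
theorem window_sum_le_geometric (N₁ : ℕ) (b : ℕ → ℝ) {M ϑ : ℝ} (hϑ0 : 0 < ϑ) (hϑ1 : ϑ ≤ 1) (hM : 0 ≤ M)
    (hb : ∀ j, b j ≤ M * ϑ ^ j) (K : ℕ) :
    ∑ j ∈ Icc (K - N₁) K, b j ≤ ((N₁ + 1) * M * ϑ⁻¹ ^ N₁) * ϑ ^ K := by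
  have hinv : 0 ≤ ϑ⁻¹ ^ N₁ := pow_nonneg (inv_nonneg.mpr hϑ0.le) _
  have hC : 0 ≤ M * (ϑ⁻¹ ^ N₁ * ϑ ^ K) := mul_nonneg hM (mul_nonneg hinv (pow_nonneg hϑ0.le _))
  have hterm : ∀ j ∈ Icc (K - N₁) K, b j ≤ M * (ϑ⁻¹ ^ N₁ * ϑ ^ K) := by
    intro j hj
    rw [mem_Icc] at hj
    refine (hb j).trans (mul_le_mul_of_nonneg_left ?_ hM)
    have h1 : ϑ ^ (j + N₁) ≤ ϑ ^ K := pow_le_pow_of_le_one hϑ0.le hϑ1 (by omega)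
    have hne : ϑ ^ N₁ ≠ 0 := pow_ne_zero _ hϑ0.ne'
    have h2 : ϑ ^ j = ϑ⁻¹ ^ N₁ * ϑ ^ (j + N₁) := by
      rw [pow_add, inv_pow]
      field_simp
    rw [h2]
    exact mul_le_mul_of_nonneg_left h1 hinv
  calc ∑ j ∈ Icc (K - N₁) K, b j ≤ ∑ _j ∈ Icc (K - N₁) K, M * (ϑ⁻¹ ^ N₁ * ϑ ^ K) := sum_le_sum hterm
    _ = ((Icc (K - N₁) K).card : ℝ) * (M * (ϑ⁻¹ ^ N₁ * ϑ ^ K)) := by rw [sum_const, nsmul_eq_mul]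
    _ ≤ ((N₁ : ℝ) + 1) * (M * (ϑ⁻¹ ^ N₁ * ϑ ^ K)) := by
        refine mul_le_mul_of_nonneg_right ?_ hC
        have h : (Icc (K - N₁) K).card ≤ N₁ + 1 := by rw [Nat.card_Icc]; omega
        exact_mod_cast h
    _ = ((N₁ + 1) * M * ϑ⁻¹ ^ N₁) * ϑ ^ K := by ring


/-- On the bounded live window the levels booked at comparison `K` are `K − N₁ ≤ j ≤ K`, so the comparisons booking
level `j` are `j ≤ K ≤ j + N₁`: `#(B j) = N₁ + 1`, uniformly in `j` — the constant of PRICE (i). [folklore] -/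
theorem window_books (N₁ K j : ℕ) (hj : j ∈ Icc (K - N₁) K) : K ∈ Icc j (j + N₁) := by
  rw [mem_Icc] at hj ⊢
  omega

/-- … and `#[j, j + N₁] = N₁ + 1`. [folklore] -/
theorem card_books (N₁ j : ℕ) : (Icc j (j + N₁)).card = N₁ + 1 := by
  rw [Nat.card_Icc]
  omega

end Summit.QuantumFields.BalabanUV.T4Continuum.Spine.NE7c.LiveFactorGlobalLevels
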